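import Mathlib.Analysis.Calculus.DerivativeTest
import Mathlib.Analysis.Calculus.LocalExtr.Basic
import Mathlib.Analysis.SpecialFunctions.ExpDeriv
import Mathlib.Analysis.SpecialFunctions.Log.Basic
import Mathlib.Analysis.SpecialFunctions.Exponential
import Literature.Analysis.FluidPDE.RadialCalculus
import Literature.Analysis.FluidPDE.HarmonicMeanValue
import HarnessLib

/-!
# Tsai's Liouville-type lemma for drift–Laplace subsolutions (the maximum-principle step of
Tsai 1998, Theorem 1)

Analysis/FluidPDE support file for the decomposition of the named fact `Literature.Analysis.FluidPDE.tsai_selfsimilar`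
(`FluidPDE/SelfSimilarLiouville`; Tsai, *On Leray's self-similar solutions of the Navier–Stokes
equations satisfying local energy estimates*, ARMA 143 (1998), Theorem 1). The heart of Tsai's
proof (§5) is a Liouville-type lemma for the "head pressure" `Π = ½|U|² + P + a y·U` of a Leray
profile, which satisfies `−νΔΠ + (U + a y)·∇Π = −ν|curl U|² ≤ 0` (Tsai 1998, (1.7)):

* **Tsai 1998, Lemma 5.1** (as printed). Let `Π : ℝ³ → ℝ`, `U : ℝ³ → ℝ³` be smooth with
  `−νΔΠ + (U + a y)·∇Π ≤ 0` on `ℝ³`. If `|U(y)| ≤ b|y|` for some `b ∈ (0, a)` and `|y|` large, and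
  `|Π(y)| = o(∫₂^{|y|} e^{c s²/2} ds)` as `|y| → ∞`, `c = (a − b)/ν`, then `Π` is constant.

Let `E` be a finite-dimensional real inner product space, `d = dim E`, and write
`L f (y) = ν Δf(y) − Df(y)[U(y) + a y]` (`Literature.NS.driftOp ν a U f y`), so that the hypothesis
reads `L Π ≥ 0`. We prove (`Literature.Analysis.FluidPDE.isConst_of_driftOp_nonneg`):

* Let `ν > 0`, `0 ≤ b < a`, `κ < (a − b)/(2ν)`, `Π ∈ C²(E)`, `U : E → E` with the affine bound
  `|U(y)| ≤ M + b|y|` for all `y`, `L Π ≥ 0` on `E` and `|Π(y)| ≤ C e^{κ|y|²}`. Then `Π` is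
  constant.

and its corollaries in Tsai's form (`U` continuous with `|U(y)| ≤ b|y|` for `|y| ≥ r₀`;
`isConst_of_driftOp_nonneg_of_eventually`) and for polynomially bounded `Π`
(`isConst_of_driftOp_nonneg_of_poly`), which is the case used in the proof of Tsai's Theorem 1
(`Π(y) = O(|y|^N)`, Tsai 1998, Lemmas 3.2–3.3 and p. 48).

## The growth hypothesis: a correction

The growth condition printed in Tsai's Lemma 5.1 is too generous. His comparison function is
`φ(r) = −(cr)⁻¹e^{cr²/2} + ∫₂^r e^{cs²/2} ds`, with `φ'(r) = e^{cr²/2}/(cr²)`, and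
`φ(r) ≍ r⁻² ∫₂^r e^{cs²/2} ds ≍ r⁻³ e^{cr²/2}`; the comparison `Π ≤ M(r₀) + ε(φ − φ(r₀))` near
infinity needs `Π = o(φ)`, not `o(∫₂^{|y|} e^{cs²/2} ds)`. Indeed, for `ν = 1`, `U(y) = −b y` and
`Π(y) = ϕ(|y|)` with `ϕ'(r) = h(r) r⁻² e^{cr²/2}`, `h` smooth, nondecreasing, `h ≡ 0` near `0` and
`h(r) = cr − 2/r` for large `r` (so that `ϕ(r) = r⁻² e^{cr²/2} + const` there), one checks
`−ΔΠ + (U + a y)·∇Π = −r⁻² h'(r) e^{cr²/2} ≤ 0`, `|U(y)| = b|y|`, and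
`|Π(y)| ≍ |y|⁻² e^{c|y|²/2} = o(∫₂^{|y|} e^{cs²/2} ds)`: every printed hypothesis holds, yet `Π`
is not constant. The exponent `c/2` is nevertheless the sharp Gaussian rate, and the version
proved here — `|Π(y)| = O(e^{κ|y|²})` for some `κ < c/2` — covers Tsai's application, where `Π`
is polynomially bounded (Theorem 1 is unaffected). We follow the elementary proof of
Lemarié-Rieusset (*The Navier–Stokes problem in the 21st century*, Lemma 16.8: the case
`Π = o(|y|²)`), replacing his quadratic penalisation `|x − X₀|²` by the Gaussian
`e^{κ₁|x − X₀|²}`, `κ < κ₁ < c/2`.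

## Proof

Suppose `Π(X₀) < Π(X₁)` and put `δ = Π(X₁) − Π(X₀)`. With `φ = e^{−β|y−X₀|²}` and
`ψ = e^{κ₁|y−X₀|²}` one has (`driftOp_gaussAt`)
`Lφ = β φ (4νβ r² − 2dν + 2⟨y − X₀, U + a y⟩)`, `Lψ = κ₁ ψ (4νκ₁ r² + 2dν − 2⟨y − X₀, U + a y⟩)`,
`r = |y − X₀|`, and `⟨y − X₀, U + a y⟩ ≥ (a − b) r² − M₁ r` (`drift_inner_lower`). Hence `Lφ > 0`
off a small ball `B(X₀, R₀)` (on which `Π ≤ Π(X₀) + δ/2`) for `β` large, and `Lψ < 0` for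
`r ≥ R₁` since `4νκ₁ < 2(a − b)`. For suitable small `γ, α > 0` the `C²` function
`V = Π + α(φ − γψ)` tends to `−∞` (the Gaussian bound on `Π`), so it has a global maximum `X₂`,
where `∇V = 0` and `ΔV ≤ 0` (`laplacian_nonpos_of_isLocalMax`), i.e. `LV(X₂) ≤ 0`. But
`V < V(X₁)` on `B(X₀, R₀)`, and `LV = LΠ + α(Lφ − γLψ) > 0` everywhere else: contradiction.

## Main statements

* `Literature.Analysis.FluidPDE.driftOp`: the operator `L`.
* `Literature.Analysis.FluidPDE.laplacian_nonpos_of_isLocalMax`: `ΔV ≤ 0` at a local maximum of a `C²` function.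
* `Literature.Analysis.FluidPDE.isConst_of_driftOp_nonneg`: the Liouville-type lemma (affine drift bound, Gaussian
  growth); `…_of_eventually` (Tsai's hypotheses on `U`), `…_of_poly` (polynomial growth).

## References

* T.-P. Tsai, *On Leray's self-similar solutions of the Navier–Stokes equations satisfying
  local energy estimates*, Arch. Rational Mech. Anal. 143 (1998) 29–51, Lemma 5.1, (1.7),
  (1.11)–(1.12) and §5 [Tsai1998].
* P. G. Lemarié-Rieusset, *The Navier–Stokes problem in the 21st century*, CRC Press, §16.8,
  Lemma 16.8 (strong maximum principle) and Theorem 16.8 [LemarieRieusset2016].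
* D. Gilbarg, N. S. Trudinger, *Elliptic partial differential equations of second order*,
  §3.1 (the weak maximum principle; second-order conditions at interior maxima)
  [GilbargTrudinger2001].
-/

noncomputable section

open MeasureTheory Set Filter Topology InnerProductSpace Function Metric
open scoped RealInnerProductSpace Laplacian ContDiff

namespace Literature.Analysis.FluidPDE

/-! ### Second-order condition at a local maximum -/

/-- At a local maximum of a real function continuous there, the (junk-valued) iterated
derivative `f''` is `≤ 0`: otherwise the second-derivative test makes the point also a local
minimum, so `f` is locally constant and `f'' = 0` there. [folklore] -/
theorem deriv_deriv_nonpos_of_isLocalMax {f : ℝ → ℝ} {x₀ : ℝ} (h : IsLocalMax f x₀)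
    (hc : ContinuousAt f x₀) : deriv (deriv f) x₀ ≤ 0 := by
  by_contra hpos
  push Not at hpos
  have hmin := isLocalMin_of_deriv_deriv_pos hpos h.deriv_eq_zero hc
  have hconst : f =ᶠ[𝓝 x₀] fun _ => f x₀ := by
    filter_upwards [h, hmin] with x h1 h2 using le_antisymm h1 h2
  have hder : deriv f =ᶠ[𝓝 x₀] fun _ => (0 : ℝ) := by
    filter_upwards [hconst.eventuallyEq_nhds] with y hy
    rw [hy.deriv_eq, deriv_const]
  have : deriv (deriv f) x₀ = 0 := by
    rw [hder.deriv_eq, deriv_const]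
  exact (lt_irrefl (0 : ℝ)) (this ▸ hpos)

section LocalMax

variable {E : Type*} [NormedAddCommGroup E] [InnerProductSpace ℝ E]

/-- Second directional derivative of a `C²` function along a line:
`(d/dt)² V(x + t v) |_{t=0} = D²V(x)(v, v)`. [folklore] -/
theorem deriv_deriv_comp_line {V : E → ℝ} (hV : ContDiff ℝ 2 V) (x v : E) :
    deriv (deriv fun t : ℝ => V (x + t • v)) 0 = iteratedFDeriv ℝ 2 V x ![v, v] := by
  have hV1 : Differentiable ℝ V := hV.differentiable (by norm_num)
  have hline : ∀ t : ℝ, HasDerivAt (fun t : ℝ => x + t • v) v t := fun t => by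
    simpa using ((hasDerivAt_id t).smul_const v).const_add x
  have h1 : deriv (fun t : ℝ => V (x + t • v)) = fun t => fderiv ℝ V (x + t • v) v := by
    funext t
    exact ((hV1 (x + t • v)).hasFDerivAt.comp_hasDerivAt t (hline t)).deriv
  rw [h1]
  have hD : Differentiable ℝ (fderiv ℝ V) :=
    (hV.fderiv_right (m := 1) le_rfl).differentiable one_ne_zero
  have hDv : Differentiable ℝ fun y => fderiv ℝ V y v := hD.clm_apply (differentiable_const v)
  have h2 : HasDerivAt ((fun y => fderiv ℝ V y v) ∘ (fun t : ℝ => x + t • v))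
      (fderiv ℝ (fun y => fderiv ℝ V y v) (x + (0 : ℝ) • v) v) 0 :=
    (hDv (x + (0 : ℝ) • v)).hasFDerivAt.comp_hasDerivAt (0 : ℝ) (hline 0)
  rw [show (fun t : ℝ => fderiv ℝ V (x + t • v) v) =
      (fun y => fderiv ℝ V y v) ∘ (fun t : ℝ => x + t • v) from rfl,
    h2.deriv, zero_smul, add_zero, iteratedFDeriv_two_apply,
    fderiv_clm_apply (hD x) (differentiableAt_const v)]
  simp

variable [FiniteDimensional ℝ E]

/-- **Second-order necessary condition at a maximum** (Gilbarg–Trudinger §3.1): if a `C²`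
function `V` has a local maximum at `x`, then `ΔV(x) ≤ 0` — each pure second derivative
`D²V(x)(eᵢ, eᵢ)` is the second derivative at `0` of `t ↦ V(x + t eᵢ)`, which has a local
maximum at `0`. [cite: GilbargTrudinger2001, §3.1] -/
theorem laplacian_nonpos_of_isLocalMax {V : E → ℝ} (hV : ContDiff ℝ 2 V)
    {x : E} (hmax : IsLocalMax V x) : (Δ V) x ≤ 0 := by
  rw [congrFun (laplacian_eq_iteratedFDeriv_stdOrthonormalBasis V) x]
  refine Finset.sum_nonpos fun i _ => ?_
  set v := stdOrthonormalBasis ℝ E i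
  rw [← deriv_deriv_comp_line hV x v]
  have hcont : Continuous fun t : ℝ => V (x + t • v) :=
    hV.continuous.comp (continuous_const.add (continuous_id.smul continuous_const))
  refine deriv_deriv_nonpos_of_isLocalMax ?_ hcont.continuousAt
  have hg : ContinuousAt (fun t : ℝ => x + t • v) 0 :=
    (continuous_const.add (continuous_id.smul continuous_const)).continuousAt
  have h0 : IsLocalMax V ((fun t : ℝ => x + t • v) 0) := by
    simp only [zero_smul, add_zero]
    exact hmax
  exact IsLocalMax.comp_continuous (g := fun t : ℝ => x + t • v) (b := 0) h0 hg

end LocalMax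

/-! ### Gaussians centred at a point -/

section GaussNorm

variable {E : Type*} [NormedAddCommGroup E]

/-- The radial Gaussian-type profile `z ↦ exp (k ‖z‖²)` (Tsai 1998, (1.12): the comparison
functions of the Liouville lemma grow like `e^{cr²/2}`). [cite: Tsai1998, (1.12)] -/
def gaussProfile (k : ℝ) (z : E) : ℝ := Real.exp (k * ‖z‖ ^ 2)

/-- The Gaussian-type radial function centred at `x₀`, `y ↦ exp (k ‖y - x₀‖²)`
(Lemarié-Rieusset, proof of Lemma 16.8: `φ_β = e^{−β|x − X₀|²}`). [cite: LemarieRieusset2016, Lemma 16.8 (proof)] -/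
def gaussAt (k : ℝ) (x₀ : E) (y : E) : ℝ := Real.exp (k * ‖y - x₀‖ ^ 2)

/-- `gaussAt k x₀ y > 0`. [folklore] -/
theorem gaussAt_pos (k : ℝ) (x₀ y : E) : 0 < gaussAt k x₀ y := Real.exp_pos _

/-- `gaussAt k x₀` is the profile `gaussProfile k` translated to `x₀`. [folklore] -/
theorem gaussAt_eq_comp (k : ℝ) (x₀ : E) :
    gaussAt k x₀ = fun y => gaussProfile k (-x₀ + y) := by
  funext y
  simp only [gaussAt, gaussProfile, neg_add_eq_sub]

/-- `gaussAt k x₀ x₀ = 1`. [folklore] -/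
theorem gaussAt_self (k : ℝ) (x₀ : E) : gaussAt k x₀ x₀ = 1 := by simp [gaussAt]

/-- For `k ≤ 0` the centred Gaussian is bounded by `1`. [folklore] -/
theorem gaussAt_le_one_of_nonpos {k : ℝ} (hk : k ≤ 0) (x₀ y : E) : gaussAt k x₀ y ≤ 1 := by
  unfold gaussAt
  rw [← Real.exp_zero]
  exact Real.exp_le_exp.2 (mul_nonpos_of_nonpos_of_nonneg hk (sq_nonneg _))

/-- For `k ≥ 0`, `gaussAt k x₀ y ≤ e^{k R²}` on the ball `|y − x₀| ≤ R`. [folklore] -/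
theorem gaussAt_mono_radius {k : ℝ} (hk : 0 ≤ k) (x₀ : E) {y : E} {R : ℝ} (h : ‖y - x₀‖ ≤ R) :
    gaussAt k x₀ y ≤ Real.exp (k * R ^ 2) := by
  unfold gaussAt
  gcongr

/-- For `k ≤ 0`, `e^{k R²} ≤ gaussAt k x₀ y` on the ball `|y − x₀| ≤ R`. [folklore] -/
theorem gaussAt_anti_radius {k : ℝ} (hk : k ≤ 0) (x₀ : E) {y : E} {R : ℝ} (h : ‖y - x₀‖ ≤ R) :
    Real.exp (k * R ^ 2) ≤ gaussAt k x₀ y := by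
  unfold gaussAt
  apply Real.exp_le_exp.2
  have : 0 ≤ -k := by linarith
  nlinarith [mul_le_mul h h (norm_nonneg _) (le_trans (norm_nonneg _) h)]

end GaussNorm

section GaussCalculus

variable {E : Type*} [NormedAddCommGroup E] [InnerProductSpace ℝ E]

/-- `gaussProfile k` is smooth. [folklore] -/
theorem contDiff_gaussProfile (k : ℝ) {n : ℕ∞} : ContDiff ℝ n (gaussProfile (E := E) k) :=
  Real.contDiff_exp.comp (contDiff_const.mul (contDiff_norm_sq ℝ))

/-- `gaussAt k x₀` is smooth. [folklore] -/
theorem contDiff_gaussAt (k : ℝ) (x₀ : E) {n : ℕ∞} : ContDiff ℝ n (gaussAt k x₀) := by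
  rw [gaussAt_eq_comp]
  exact (contDiff_gaussProfile k).comp (contDiff_const.add contDiff_id)

/-- `(e^{k s})' = k e^{k s}`. [folklore] -/
theorem hasDerivAt_exp_const_mul (k σ : ℝ) :
    HasDerivAt (fun s => Real.exp (k * s)) (k * Real.exp (k * σ)) σ := by
  have := ((hasDerivAt_id σ).const_mul k).exp
  simpa [mul_comm] using this

/-- `D(e^{k|·|²})(z) v = 2 k e^{k|z|²} ⟨z, v⟩` (radial calculus, `fderiv_comp_norm_sq_apply`). [folklore] -/
theorem fderiv_gaussProfile_apply (k : ℝ) (z v : E) :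
    fderiv ℝ (gaussProfile k) z v = 2 * (k * gaussProfile k z) * ⟪z, v⟫ :=
  fderiv_comp_norm_sq_apply (hasDerivAt_exp_const_mul k (‖z‖ ^ 2)) v

/-- `Δ(e^{k|·|²})(z) = (4 k² |z|² + 2 d k) e^{k|z|²}`, `d = dim E` (radial calculus,
`laplacian_comp_norm_sq`; Lemarié-Rieusset, proof of Lemma 16.8, the formula for `𝓛φ_β`). [cite: LemarieRieusset2016, Lemma 16.8 (proof)] -/
theorem laplacian_gaussProfile [FiniteDimensional ℝ E] (k : ℝ) (z : E) :
    (Δ (gaussProfile (E := E) k)) z =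
      (4 * k ^ 2 * ‖z‖ ^ 2 + 2 * (Module.finrank ℝ E) * k) * gaussProfile k z := by
  have h := laplacian_comp_norm_sq (E := E) (g := fun s => Real.exp (k * s))
    (g₁ := fun s => k * Real.exp (k * s)) (g₂ := k * (k * Real.exp (k * ‖z‖ ^ 2)))
    (U := univ) isOpen_univ (fun σ _ => hasDerivAt_exp_const_mul k σ) (mem_univ _)
    ((hasDerivAt_exp_const_mul k (‖z‖ ^ 2)).const_mul k)
  unfold gaussProfile
  rw [h]
  ring

/-- `D(gaussAt k x₀)(y) v = 2 k · gaussAt k x₀ y · ⟨y − x₀, v⟩`. [folklore] -/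
theorem fderiv_gaussAt_apply (k : ℝ) (x₀ y v : E) :
    fderiv ℝ (gaussAt k x₀) y v = 2 * k * gaussAt k x₀ y * ⟪y - x₀, v⟫ := by
  rw [gaussAt_eq_comp, fderiv_comp_add_left, fderiv_gaussProfile_apply]
  simp only [neg_add_eq_sub]
  ring

/-- `Δ(gaussAt k x₀)(y) = (4 k² |y − x₀|² + 2 d k) · gaussAt k x₀ y`. [cite: LemarieRieusset2016, Lemma 16.8 (proof)] -/
theorem laplacian_gaussAt [FiniteDimensional ℝ E] (k : ℝ) (x₀ y : E) :
    (Δ (gaussAt k x₀)) y =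
      (4 * k ^ 2 * ‖y - x₀‖ ^ 2 + 2 * (Module.finrank ℝ E) * k) * gaussAt k x₀ y := by
  rw [gaussAt_eq_comp, laplacian_comp_const_add, laplacian_gaussProfile]
  simp only [neg_add_eq_sub]

end GaussCalculus

/-! ### The drift operator `L f = ν Δf − Df[U + a y]` -/

section Drift

variable {E : Type*} [NormedAddCommGroup E] [InnerProductSpace ℝ E]

/-- The drift–Laplace operator `L f (y) = ν Δf(y) − Df(y)[U(y) + a y]` of Tsai's Lemma 5.1
(written with the sign of Lemarié-Rieusset's `𝓛 = νΔ − (b⃗ + X⃗)·∇`; Tsai's (5.1) is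
`−L Π ≤ 0`). Here `Df(y)[v] = ⟨v, ∇f(y)⟩`. [cite: Tsai1998, Lemma 5.1 and (5.1)] -/
def driftOp [FiniteDimensional ℝ E] (ν a : ℝ) (U : E → E) (f : E → ℝ) (y : E) : ℝ :=
  ν * (Δ f) y - fderiv ℝ f y (U y + a • y)

/-- Radial component of the drift about a centre `x₀`, lower bound: if `|U(y)| ≤ M + b|y|` then
`⟨y − x₀, U(y) + a y⟩ ≥ (a − b)|y − x₀|² − (M + (a + b)|x₀|)|y − x₀|` (Lemarié-Rieusset, proof of
Lemma 16.8: "`|b⃗(x) + X⃗₀| ≤ |x − X₀|/2` for `|x − X₀| ≥ R₁`"). [cite: LemarieRieusset2016, Lemma 16.8 (proof)] -/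
theorem drift_inner_lower {a b M : ℝ} (hb : 0 ≤ b) (ha : 0 ≤ a) {U : E → E}
    (hU : ∀ y, ‖U y‖ ≤ M + b * ‖y‖) (x₀ y : E) :
    (a - b) * ‖y - x₀‖ ^ 2 - (M + (a + b) * ‖x₀‖) * ‖y - x₀‖ ≤ ⟪y - x₀, U y + a • y⟫ := by
  set w := y - x₀ with hw
  have hy : y = x₀ + w := by rw [hw]; abel
  have hsplit : U y + a • y = (U y + a • x₀) + a • w := by
    rw [hy]; simp only [smul_add]; abel
  have hnorm_y : ‖y‖ ≤ ‖w‖ + ‖x₀‖ := by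
    rw [hy, add_comm]; exact (norm_add_le _ _).trans (by rw [add_comm])
  have h1 : ⟪w, a • w⟫ = a * ‖w‖ ^ 2 := by
    rw [real_inner_smul_right, real_inner_self_eq_norm_sq]
  have h2 : |⟪w, U y + a • x₀⟫| ≤ ‖w‖ * (M + b * (‖w‖ + ‖x₀‖) + a * ‖x₀‖) := by
    refine (abs_real_inner_le_norm _ _).trans ?_
    gcongr
    refine (norm_add_le _ _).trans ?_
    rw [norm_smul, Real.norm_eq_abs, abs_of_nonneg ha]
    gcongr
    exact (hU y).trans (by gcongr)
  rw [hsplit, inner_add_right, h1]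
  have h3 := neg_abs_le ⟪w, U y + a • x₀⟫
  nlinarith [h2, h3, norm_nonneg w]

/-- Radial component of the drift about a centre `x₀`, upper bound:
`|⟨y − x₀, U(y) + a y⟩| ≤ ((M + (a + b)|x₀|) + (a + b)|y − x₀|)|y − x₀|`. [folklore] -/
theorem abs_drift_inner_le {a b M : ℝ} (hb : 0 ≤ b) (ha : 0 ≤ a) {U : E → E}
    (hU : ∀ y, ‖U y‖ ≤ M + b * ‖y‖) (x₀ y : E) :
    |⟪y - x₀, U y + a • y⟫| ≤ ((M + (a + b) * ‖x₀‖) + (a + b) * ‖y - x₀‖) * ‖y - x₀‖ := by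
  set w := y - x₀ with hw
  have hy : y = x₀ + w := by rw [hw]; abel
  have hnorm_y : ‖y‖ ≤ ‖w‖ + ‖x₀‖ := by
    rw [hy, add_comm]; exact (norm_add_le _ _).trans (by rw [add_comm])
  refine (abs_real_inner_le_norm _ _).trans ?_
  rw [mul_comm]
  gcongr
  refine (norm_add_le _ _).trans ?_
  rw [norm_smul, Real.norm_eq_abs, abs_of_nonneg ha]
  have := hU y
  nlinarith [hnorm_y, this, norm_nonneg w, norm_nonneg x₀]

variable [FiniteDimensional ℝ E]

/-- `L` on a centred Gaussian:
`L(gaussAt k x₀)(y) = gaussAt k x₀ y · (ν(4k²r² + 2dk) − 2k⟨y − x₀, U(y) + a y⟩)`, `r = |y − x₀|`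
(Lemarié-Rieusset, proof of Lemma 16.8, the formulas for `𝓛φ_β` and `𝓛ψ`). [cite: LemarieRieusset2016, Lemma 16.8 (proof)] -/
theorem driftOp_gaussAt (ν a k : ℝ) (U : E → E) (x₀ y : E) :
    driftOp ν a U (gaussAt k x₀) y =
      gaussAt k x₀ y * (ν * (4 * k ^ 2 * ‖y - x₀‖ ^ 2 + 2 * (Module.finrank ℝ E) * k) -
        2 * k * ⟪y - x₀, U y + a • y⟫) := by
  unfold driftOp
  rw [laplacian_gaussAt, fderiv_gaussAt_apply]
  ring

/-- Linearity of `L` on `C²` functions: `L(Π + α(φ − γψ)) = LΠ + α(Lφ − γLψ)`. [folklore] -/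
theorem driftOp_add_smul_sub (ν a : ℝ) (U : E → E) {Θ φ ψ : E → ℝ} (hΘ : ContDiff ℝ 2 Θ)
    (hφ : ContDiff ℝ 2 φ) (hψ : ContDiff ℝ 2 ψ) (α γ : ℝ) (y : E) :
    driftOp ν a U (Θ + α • (φ - γ • ψ)) y =
      driftOp ν a U Θ y + α * (driftOp ν a U φ y - γ * driftOp ν a U ψ y) := by
  unfold driftOp
  have h2 : (2 : WithTop ℕ∞) ≠ 0 := by norm_num
  have hγψ : ContDiff ℝ 2 (γ • ψ) := contDiff_const.smul hψ
  have hd : ContDiff ℝ 2 (φ - γ • ψ) := hφ.sub hγψ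
  have hsd : ContDiff ℝ 2 (α • (φ - γ • ψ)) := contDiff_const.smul hd
  have L1 : (Δ (Θ + α • (φ - γ • ψ))) y = (Δ Θ) y + (Δ (α • (φ - γ • ψ))) y :=
    hΘ.contDiffAt.laplacian_add hsd.contDiffAt
  have L2 : (Δ (α • (φ - γ • ψ))) y = α • (Δ (φ - γ • ψ)) y := laplacian_smul α hd.contDiffAt
  have L3 : (Δ (φ - γ • ψ)) y = (Δ φ) y - (Δ (γ • ψ)) y :=
    hφ.contDiffAt.laplacian_sub hγψ.contDiffAt
  have L4 : (Δ (γ • ψ)) y = γ • (Δ ψ) y := laplacian_smul γ hψ.contDiffAt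
  have dΘ : DifferentiableAt ℝ Θ y := (hΘ.differentiable h2) y
  have dφ : DifferentiableAt ℝ φ y := (hφ.differentiable h2) y
  have dψ : DifferentiableAt ℝ ψ y := (hψ.differentiable h2) y
  have dγψ : DifferentiableAt ℝ (γ • ψ) y := (hγψ.differentiable h2) y
  have dd : DifferentiableAt ℝ (φ - γ • ψ) y := (hd.differentiable h2) y
  have dsd : DifferentiableAt ℝ (α • (φ - γ • ψ)) y := (hsd.differentiable h2) y
  have D1 : fderiv ℝ (Θ + α • (φ - γ • ψ)) y = fderiv ℝ Θ y + fderiv ℝ (α • (φ - γ • ψ)) y :=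
    fderiv_add dΘ dsd
  have D2 : fderiv ℝ (α • (φ - γ • ψ)) y = α • fderiv ℝ (φ - γ • ψ) y := fderiv_const_smul dd α
  have D3 : fderiv ℝ (φ - γ • ψ) y = fderiv ℝ φ y - fderiv ℝ (γ • ψ) y := fderiv_sub dφ dγψ
  have D4 : fderiv ℝ (γ • ψ) y = γ • fderiv ℝ ψ y := fderiv_const_smul dψ γ
  rw [L1, L2, L3, L4, D1, D2, D3, D4]
  simp only [smul_eq_mul, add_apply, FunLike.coe_smul, FunLike.coe_sub, Pi.smul_apply,
    Pi.sub_apply]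
  ring

/-- The barrier `φ = e^{−β|y−x₀|²}`, `β ≥ 0`: `Lφ ≥ βφ(4νβ r² − 2(M + (a+b)|x₀|) r − 2dν)`
(Lemarié-Rieusset, proof of Lemma 16.8, choice of `β`). [cite: LemarieRieusset2016, Lemma 16.8 (proof)] -/
theorem driftOp_gaussAt_neg_lower {ν a b M β : ℝ} (hb : 0 ≤ b) (hba : b ≤ a)
    (hβ : 0 ≤ β) {U : E → E} (hU : ∀ y, ‖U y‖ ≤ M + b * ‖y‖) (x₀ y : E) :
    β * gaussAt (-β) x₀ y *
        (4 * ν * β * ‖y - x₀‖ ^ 2 - 2 * (M + (a + b) * ‖x₀‖) * ‖y - x₀‖ -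
          2 * (Module.finrank ℝ E) * ν) ≤ driftOp ν a U (gaussAt (-β) x₀) y := by
  rw [driftOp_gaussAt]
  have ha : 0 ≤ a := hb.trans hba
  have hlow := drift_inner_lower hb ha hU x₀ y
  have hpos := (gaussAt_pos (-β) x₀ y).le
  have hab : 0 ≤ (a - b) * ‖y - x₀‖ ^ 2 := mul_nonneg (sub_nonneg.2 hba) (sq_nonneg _)
  have key : β * (4 * ν * β * ‖y - x₀‖ ^ 2 - 2 * (M + (a + b) * ‖x₀‖) * ‖y - x₀‖ -
      2 * (Module.finrank ℝ E) * ν) ≤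
      ν * (4 * (-β) ^ 2 * ‖y - x₀‖ ^ 2 + 2 * (Module.finrank ℝ E) * (-β)) -
        2 * (-β) * ⟪y - x₀, U y + a • y⟫ := by
    have h' : -((M + (a + b) * ‖x₀‖) * ‖y - x₀‖) ≤ ⟪y - x₀, U y + a • y⟫ := by
      linarith
    nlinarith [mul_le_mul_of_nonneg_left h' hβ]
  calc _ = gaussAt (-β) x₀ y * (β * (4 * ν * β * ‖y - x₀‖ ^ 2 -
      2 * (M + (a + b) * ‖x₀‖) * ‖y - x₀‖ - 2 * (Module.finrank ℝ E) * ν)) := by ring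
    _ ≤ _ := mul_le_mul_of_nonneg_left key hpos

/-- The penalisation `ψ = e^{k|y−x₀|²}`, `k ≥ 0`:
`Lψ ≤ kψ(2dν + 2(M + (a+b)|x₀|) r − (2(a − b) − 4νk) r²)` — negative far out when
`k < (a − b)/(2ν)` (Tsai 1998, (1.11)–(1.12): `y·∇` is a "magnifying force" at this Gaussian
rate). [cite: Tsai1998, (1.11)–(1.12) and Lemma 5.1] -/
theorem driftOp_gaussAt_upper {ν a b M k : ℝ} (hb : 0 ≤ b) (hba : b ≤ a)
    (hk : 0 ≤ k) {U : E → E} (hU : ∀ y, ‖U y‖ ≤ M + b * ‖y‖) (x₀ y : E) :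
    driftOp ν a U (gaussAt k x₀) y ≤ k * gaussAt k x₀ y *
      (2 * (Module.finrank ℝ E) * ν + 2 * (M + (a + b) * ‖x₀‖) * ‖y - x₀‖ -
        (2 * (a - b) - 4 * ν * k) * ‖y - x₀‖ ^ 2) := by
  rw [driftOp_gaussAt]
  have ha : 0 ≤ a := hb.trans hba
  have hlow := drift_inner_lower hb ha hU x₀ y
  have hpos := (gaussAt_pos k x₀ y).le
  have key : ν * (4 * k ^ 2 * ‖y - x₀‖ ^ 2 + 2 * (Module.finrank ℝ E) * k) -
      2 * k * ⟪y - x₀, U y + a • y⟫ ≤ k * (2 * (Module.finrank ℝ E) * ν +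
        2 * (M + (a + b) * ‖x₀‖) * ‖y - x₀‖ - (2 * (a - b) - 4 * ν * k) * ‖y - x₀‖ ^ 2) := by
    nlinarith [mul_le_mul_of_nonneg_left hlow hk]
  calc _ ≤ gaussAt k x₀ y * (k * (2 * (Module.finrank ℝ E) * ν +
        2 * (M + (a + b) * ‖x₀‖) * ‖y - x₀‖ - (2 * (a - b) - 4 * ν * k) * ‖y - x₀‖ ^ 2)) :=
        mul_le_mul_of_nonneg_left key hpos
    _ = _ := by ring

/-- The penalisation `ψ = e^{k|y−x₀|²}`, `k ≥ 0`, `ν ≥ 0`: the crude bound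
`|Lψ| ≤ kψ(4νk r² + 2dν + 2((M + (a+b)|x₀|) + (a+b) r) r)`. [folklore] -/
theorem abs_driftOp_gaussAt_le {ν a b M k : ℝ} (hν : 0 ≤ ν) (hb : 0 ≤ b) (hba : b ≤ a)
    (hk : 0 ≤ k) {U : E → E} (hU : ∀ y, ‖U y‖ ≤ M + b * ‖y‖) (x₀ y : E) :
    |driftOp ν a U (gaussAt k x₀) y| ≤ k * gaussAt k x₀ y *
      (4 * ν * k * ‖y - x₀‖ ^ 2 + 2 * (Module.finrank ℝ E) * ν +
        2 * ((M + (a + b) * ‖x₀‖) + (a + b) * ‖y - x₀‖) * ‖y - x₀‖) := by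
  rw [driftOp_gaussAt, abs_mul, abs_of_pos (gaussAt_pos _ _ _)]
  have ha : 0 ≤ a := hb.trans hba
  have habs := abs_drift_inner_le hb ha hU x₀ y
  have hpos := (gaussAt_pos k x₀ y).le
  have hd : (0 : ℝ) ≤ Module.finrank ℝ E := Nat.cast_nonneg _
  have key : |ν * (4 * k ^ 2 * ‖y - x₀‖ ^ 2 + 2 * (Module.finrank ℝ E) * k) -
      2 * k * ⟪y - x₀, U y + a • y⟫| ≤ k * (4 * ν * k * ‖y - x₀‖ ^ 2 +
        2 * (Module.finrank ℝ E) * ν + 2 * ((M + (a + b) * ‖x₀‖) + (a + b) * ‖y - x₀‖) *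
          ‖y - x₀‖) := by
    refine (abs_sub _ _).trans ?_
    rw [abs_of_nonneg (by positivity : 0 ≤ ν * (4 * k ^ 2 * ‖y - x₀‖ ^ 2 +
      2 * (Module.finrank ℝ E) * k)), abs_mul, abs_of_nonneg (by positivity : 0 ≤ 2 * k)]
    nlinarith [mul_le_mul_of_nonneg_left habs (by positivity : 0 ≤ 2 * k)]
  calc _ ≤ gaussAt k x₀ y * (k * (4 * ν * k * ‖y - x₀‖ ^ 2 +
        2 * (Module.finrank ℝ E) * ν + 2 * ((M + (a + b) * ‖x₀‖) + (a + b) * ‖y - x₀‖) *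
          ‖y - x₀‖)) := mul_le_mul_of_nonneg_left key hpos
    _ = _ := by ring

/-- At a global maximum `x` of a `C²` function `V`, `LV(x) = νΔV(x) ≤ 0` for `ν ≥ 0`
(`∇V(x) = 0`, `ΔV(x) ≤ 0`; Lemarié-Rieusset, proof of Lemma 16.8: "at this point, we must have
`∇V(X₂) = 0` and `ΔV(X₂) ≤ 0`. Thus, we have `𝓛V(X₂) ≤ 0`"). [cite: LemarieRieusset2016, Lemma 16.8 (proof)] -/
theorem driftOp_nonpos_of_isMax {ν a : ℝ} (hν : 0 ≤ ν) (U : E → E) {V : E → ℝ}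
    (hV : ContDiff ℝ 2 V) {x : E} (hmax : ∀ y, V y ≤ V x) : driftOp ν a U V x ≤ 0 := by
  have hloc : IsLocalMax V x := Filter.Eventually.of_forall hmax
  unfold driftOp
  rw [hloc.fderiv_eq_zero, zero_apply, sub_zero]
  exact mul_nonpos_of_nonneg_of_nonpos hν (laplacian_nonpos_of_isLocalMax hV hloc)

/-- A continuous function which, outside the closed ball `B̄(x₀, R)`, stays below its value at
some point `x₁` of that ball, attains a global maximum (compactness of closed balls in finite
dimension). [folklore] -/
theorem exists_forall_le_of_le_outside {V : E → ℝ} (hV : Continuous V) {x₀ x₁ : E} {R : ℝ}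
    (hx₁ : ‖x₁ - x₀‖ ≤ R) (hout : ∀ y, R ≤ ‖y - x₀‖ → V y ≤ V x₁) :
    ∃ x₂, ∀ y, V y ≤ V x₂ := by
  have hcpt : IsCompact (closedBall x₀ R) := isCompact_closedBall x₀ R
  have hx₁mem : x₁ ∈ closedBall x₀ R := by rwa [mem_closedBall, dist_eq_norm]
  obtain ⟨x₂, -, hx₂⟩ := hcpt.exists_isMaxOn ⟨x₁, hx₁mem⟩ hV.continuousOn
  refine ⟨x₂, fun y => ?_⟩
  by_cases hy : y ∈ closedBall x₀ R
  · exact hx₂ hy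
  · rw [mem_closedBall, dist_eq_norm, not_le] at hy
    exact (hout y hy.le).trans (hx₂ hx₁mem)

end Drift

/-! ### Elementary real inequalities used to fix the constants -/

/-- For `p > 0`, the quadratic `p r² − q r − c` is `≥ 1` for all large `r`. [folklore] -/
theorem exists_forall_ge_one_le_quad {p : ℝ} (hp : 0 < p) (q c : ℝ) :
    ∃ R : ℝ, 0 < R ∧ ∀ r : ℝ, R ≤ r → 1 ≤ p * r ^ 2 - q * r - c := by
  refine ⟨max 1 ((|q| + |c| + 1) / p), lt_max_of_lt_left one_pos, fun r hr => ?_⟩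
  have hr1 : 1 ≤ r := (le_max_left _ _).trans hr
  have hr2 : (|q| + |c| + 1) / p ≤ r := (le_max_right _ _).trans hr
  have hr0 : 0 ≤ r := zero_le_one.trans hr1
  have h3 : |q| + |c| + 1 ≤ p * r := by rwa [div_le_iff₀' hp] at hr2
  have h4 : (|q| + |c| + 1) * r ≤ p * r ^ 2 := by nlinarith
  have hq : q * r ≤ |q| * r := by gcongr; exact le_abs_self q
  have hc : c ≤ |c| * r := (le_abs_self c).trans (le_mul_of_one_le_right (abs_nonneg c) hr1)
  nlinarith

/-- Arithmetic for the barrier: `1 ≤ 4νβ r² − 2 M₁ r − 2 d ν` for `r ≥ R₀ > 0` when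
`4νβ R₀² = 2 M₁ R₀ + 2 d ν + 1` (`M₁, d, ν ≥ 0`). [folklore] -/
theorem one_le_barrier_quad {ν β M₁ d R₀ r : ℝ} (hν : 0 ≤ ν) (hM₁ : 0 ≤ M₁) (hd : 0 ≤ d)
    (hR₀ : 0 < R₀) (hβeq : 4 * ν * β * R₀ ^ 2 = 2 * M₁ * R₀ + 2 * d * ν + 1) (hr : R₀ ≤ r) :
    1 ≤ 4 * ν * β * r ^ 2 - 2 * M₁ * r - 2 * d * ν := by
  have hr0 : 0 ≤ r := hR₀.le.trans hr
  have h1 : R₀ * R₀ ≤ r * r := mul_le_mul hr hr hR₀.le hr0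
  have h2 : R₀ * R₀ * r ≤ R₀ * r * r := by
    have := mul_le_mul_of_nonneg_left hr (mul_nonneg hR₀.le hr0)
    linarith [this]
  have key : R₀ ^ 2 * 1 ≤ R₀ ^ 2 * (4 * ν * β * r ^ 2 - 2 * M₁ * r - 2 * d * ν) := by
    have e1 : R₀ ^ 2 * (4 * ν * β * r ^ 2) = (2 * M₁ * R₀ + 2 * d * ν + 1) * r ^ 2 := by
      rw [← hβeq]; ring
    rw [mul_sub, mul_sub, e1]
    nlinarith [mul_nonneg hM₁ hR₀.le, mul_nonneg hd hν]
  exact le_of_mul_le_mul_left key (by positivity)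

/-- Arithmetic for the penalisation: `1 ≤ B r² − 2 M₁ r − 2 d ν` for `r ≥ 1` with
`2 M₁ + 2 d ν + 1 ≤ B r` (`d, ν ≥ 0`). [folklore] -/
theorem one_le_penal_quad {ν B M₁ d r : ℝ} (hν : 0 ≤ ν) (hd : 0 ≤ d)
    (hr : 1 ≤ r) (hBr : 2 * M₁ + 2 * d * ν + 1 ≤ B * r) :
    1 ≤ B * r ^ 2 - 2 * M₁ * r - 2 * d * ν := by
  have hr0 : 0 ≤ r := zero_le_one.trans hr
  have : (2 * M₁ + 2 * d * ν + 1) * r ≤ B * r * r := mul_le_mul_of_nonneg_right hBr hr0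
  nlinarith [mul_nonneg hd hν, mul_nonneg (mul_nonneg hd hν) hr0]

/-- `(1 + r)^N ≤ N! · e^{1 + 1/(4κ)} · e^{κ r²}` for `r ≥ 0`, `κ > 0`: polynomial growth is
Gaussian growth at every positive rate (`xᴺ/N! ≤ eˣ` and `r ≤ κr² + 1/(4κ)`). [folklore] -/
theorem one_add_pow_le_exp_mul_sq {κ : ℝ} (hκ : 0 < κ) (N : ℕ) {r : ℝ} (hr : 0 ≤ r) :
    (1 + r) ^ N ≤ (N.factorial * Real.exp (1 + 1 / (4 * κ))) * Real.exp (κ * r ^ 2) := by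
  have h1 : (1 + r) ^ N / N.factorial ≤ Real.exp (1 + r) :=
    Real.pow_div_factorial_le_exp _ (by linarith) N
  have hN : (0 : ℝ) < N.factorial := by exact_mod_cast Nat.factorial_pos N
  rw [div_le_iff₀ hN] at h1
  have h2 : 1 + r ≤ 1 + 1 / (4 * κ) + κ * r ^ 2 := by
    have : 0 ≤ κ * (r - 1 / (2 * κ)) ^ 2 := by positivity
    have e : κ * (r - 1 / (2 * κ)) ^ 2 = κ * r ^ 2 - r + 1 / (4 * κ) := by
      field_simp
      ring
    linarith
  calc (1 + r) ^ N ≤ Real.exp (1 + r) * N.factorial := h1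
    _ ≤ Real.exp (1 + 1 / (4 * κ) + κ * r ^ 2) * N.factorial := by gcongr
    _ = _ := by rw [Real.exp_add]; ring

/-! ### The Liouville-type lemma -/

section Liouville

variable {E : Type*} [NormedAddCommGroup E] [InnerProductSpace ℝ E] [FiniteDimensional ℝ E]

omit [InnerProductSpace ℝ E] [FiniteDimensional ℝ E] in
/-- Decay step of the proof: a function `V = Θ + α(φ − γψ)` with `|Θ(y)| ≤ C e^{κ|y|²}`,
`φ ≤ 1`, `ψ(y) = e^{κ₁|y−x₀|²}`, `0 ≤ κ₀ < κ₁`, `κ ≤ κ₀`, `α, γ > 0`, stays below any prescribed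
value `V(x₁)` outside a large ball about `x₀` (Lemarié-Rieusset, proof of Lemma 16.8:
"`V(x) ∼ −αγ|x|²` when `x → ∞`, thus `V` has a maximum", here with the Gaussian
penalisation). [cite: LemarieRieusset2016, Lemma 16.8 (proof)] -/
theorem le_far_of_gauss_penalisation {Θ φ ψ V : E → ℝ} {x₀ : E} {C κ κ₀ κ₁ α γ : ℝ}
    (hC : 0 ≤ C) (hgrowth : ∀ y, |Θ y| ≤ C * Real.exp (κ * ‖y‖ ^ 2)) (hκκ₀ : κ ≤ κ₀)
    (hκ₀0 : 0 ≤ κ₀) (hκ₀₁ : κ₀ < κ₁) (hκ₁0 : 0 < κ₁)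
    (hψeq : ∀ y, ψ y = Real.exp (κ₁ * ‖y - x₀‖ ^ 2)) (hφle1 : ∀ y, φ y ≤ 1)
    (hα0 : 0 < α) (hγ0 : 0 < γ)
    (hVapply : ∀ y, V y = Θ y + α * (φ y - γ * ψ y)) (x₁ : E) (R₁ : ℝ) :
    ∃ R₂ : ℝ, R₁ ≤ R₂ ∧ ∀ y, R₂ ≤ ‖y - x₀‖ → V y ≤ V x₁ := by
  obtain ⟨Ra, -, hRa⟩ := exists_forall_ge_one_le_quad (sub_pos.2 hκ₀₁) (2 * κ₀ * ‖x₀‖)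
    (κ₀ * ‖x₀‖ ^ 2 + Real.log (C + 1) - Real.log (α * γ / 2))
  obtain ⟨Rb, -, hRb⟩ := exists_forall_ge_one_le_quad hκ₁0 0 (2 * (α + |V x₁|) / (α * γ))
  refine ⟨max R₁ (max Ra Rb), le_max_left _ _, fun y hy => ?_⟩
  have hra : Ra ≤ ‖y - x₀‖ := ((le_max_left _ _).trans (le_max_right _ _)).trans hy
  have hrb : Rb ≤ ‖y - x₀‖ := ((le_max_right _ _).trans (le_max_right _ _)).trans hy
  have hαγ : 0 < α * γ / 2 := by positivity
  have hC1 : 0 < C + 1 := by linarith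
  -- `|Θ y| ≤ (αγ/2) ψ y`
  have hΘy : |Θ y| ≤ α * γ / 2 * ψ y := by
    have hny : ‖y‖ ≤ ‖y - x₀‖ + ‖x₀‖ := by
      have := norm_add_le (y - x₀) x₀
      rwa [sub_add_cancel] at this
    have hexp : Real.exp (κ * ‖y‖ ^ 2) ≤ Real.exp (κ₀ * (‖y - x₀‖ + ‖x₀‖) ^ 2) := by
      apply Real.exp_le_exp.2
      refine (mul_le_mul_of_nonneg_right hκκ₀ (sq_nonneg _)).trans ?_
      exact mul_le_mul_of_nonneg_left (pow_le_pow_left₀ (norm_nonneg _) hny 2) hκ₀0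
    have h1 : |Θ y| ≤ (C + 1) * Real.exp (κ₀ * (‖y - x₀‖ + ‖x₀‖) ^ 2) :=
      (hgrowth y).trans (mul_le_mul (by linarith) hexp (Real.exp_pos _).le hC1.le)
    have h2 : Real.log (C + 1) + κ₀ * (‖y - x₀‖ + ‖x₀‖) ^ 2 ≤
        Real.log (α * γ / 2) + κ₁ * ‖y - x₀‖ ^ 2 := by
      have := hRa _ hra
      have e : κ₀ * (‖y - x₀‖ + ‖x₀‖) ^ 2 =
          κ₀ * ‖y - x₀‖ ^ 2 + 2 * κ₀ * ‖x₀‖ * ‖y - x₀‖ + κ₀ * ‖x₀‖ ^ 2 := by ring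
      linarith
    have h3 : (C + 1) * Real.exp (κ₀ * (‖y - x₀‖ + ‖x₀‖) ^ 2) ≤ α * γ / 2 * ψ y :=
      calc (C + 1) * Real.exp (κ₀ * (‖y - x₀‖ + ‖x₀‖) ^ 2)
          = Real.exp (Real.log (C + 1) + κ₀ * (‖y - x₀‖ + ‖x₀‖) ^ 2) := by
            rw [Real.exp_add, Real.exp_log hC1]
        _ ≤ Real.exp (Real.log (α * γ / 2) + κ₁ * ‖y - x₀‖ ^ 2) := Real.exp_le_exp.2 h2
        _ = α * γ / 2 * ψ y := by rw [Real.exp_add, Real.exp_log hαγ, hψeq]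
    exact h1.trans h3
  -- `(αγ/2) ψ y ≥ α + |V x₁|`
  have hψbig : α + |V x₁| ≤ α * γ / 2 * ψ y := by
    have h1 := hRb _ hrb
    have h3 : κ₁ * ‖y - x₀‖ ^ 2 + 1 ≤ ψ y := by rw [hψeq]; exact Real.add_one_le_exp _
    have h4 : α + |V x₁| = α * γ / 2 * (2 * (α + |V x₁|) / (α * γ)) := by
      field_simp
    rw [h4]
    exact mul_le_mul_of_nonneg_left (by linarith) hαγ.le
  rw [hVapply]
  have h5 : Θ y ≤ |Θ y| := le_abs_self _
  have h6 : α * (φ y - γ * ψ y) = α * φ y - α * γ * ψ y := by ring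
  have h6' : α * φ y ≤ α * 1 := mul_le_mul_of_nonneg_left (hφle1 y) hα0.le
  have h7 : -|V x₁| ≤ V x₁ := neg_abs_le _
  have hψ0 : 0 ≤ ψ y := by rw [hψeq]; exact (Real.exp_pos _).le
  linarith

/-- **Tsai's Liouville-type lemma, corrected growth, affine drift bound** (Tsai 1998,
Lemma 5.1; Lemarié-Rieusset, Lemma 16.8 with a Gaussian in place of the quadratic
penalisation). Let `E` be a finite-dimensional real inner product space, `ν > 0`, `0 ≤ b < a`,
`κ < (a − b)/(2ν)`. Let `Θ ∈ C²(E)` and `U : E → E` satisfy `|U(y)| ≤ M + b|y|` for all `y`,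
`ν ΔΘ − DΘ[U + a y] ≥ 0` on `E` (that is, `−νΔΘ + (U + a y)·∇Θ ≤ 0`, Tsai's (5.1)) and
`|Θ(y)| ≤ C e^{κ|y|²}`. Then `Θ` is constant. See the module docstring for why the growth bound
`o(∫₂^{|y|} e^{cs²/2} ds)`, `c = (a − b)/ν`, printed in Tsai's Lemma 5.1 has to be replaced (the
Gaussian exponent `κ < c/2` is sharp). [cite: LemarieRieusset2016, Lemma 16.8] -/
theorem isConst_of_driftOp_nonneg {ν a b M κ C : ℝ} (hν : 0 < ν) (hb : 0 ≤ b) (hba : b < a)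
    (hκ : κ < (a - b) / (2 * ν)) {Θ : E → ℝ} {U : E → E} (hΘ : ContDiff ℝ 2 Θ)
    (hsub : ∀ y, 0 ≤ driftOp ν a U Θ y) (hU : ∀ y, ‖U y‖ ≤ M + b * ‖y‖)
    (hgrowth : ∀ y, |Θ y| ≤ C * Real.exp (κ * ‖y‖ ^ 2)) (x y : E) : Θ x = Θ y := by
  -- reduce to: no pair `X₀, X₁` with `Θ X₀ < Θ X₁`
  suffices key : ∀ X₀ X₁ : E, ¬ (Θ X₀ < Θ X₁) by
    rcases lt_trichotomy (Θ x) (Θ y) with h | h | h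
    · exact absurd h (key x y)
    · exact h
    · exact absurd h (key y x)
  intro X₀ X₁ hlt
  -- basic constants
  have ha : 0 < a := hb.trans_lt hba
  have hab : 0 < a - b := sub_pos.2 hba
  have hM : 0 ≤ M := by
    have := hU 0
    rw [norm_zero, mul_zero, add_zero] at this
    exact (norm_nonneg _).trans this
  have hC : 0 ≤ C := by
    have := hgrowth 0
    rw [norm_zero] at this
    norm_num at this
    exact (abs_nonneg _).trans this
  have hd0 : (0 : ℝ) ≤ (Module.finrank ℝ E : ℝ) := Nat.cast_nonneg _
  obtain ⟨δ, hδ0, hδ⟩ : ∃ δ : ℝ, 0 < δ ∧ Θ X₁ = Θ X₀ + δ := ⟨Θ X₁ - Θ X₀, sub_pos.2 hlt, by ring⟩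
  have hX : X₁ ≠ X₀ := fun h => by rw [h] at hlt; exact lt_irrefl _ hlt
  have hs₁0 : 0 < ‖X₁ - X₀‖ := norm_pos_iff.2 (sub_ne_zero.2 hX)
  obtain ⟨M₁, hM₁0, hM₁⟩ : ∃ M₁ : ℝ, 0 ≤ M₁ ∧ M₁ = M + (a + b) * ‖X₀‖ :=
    ⟨_, by positivity, rfl⟩
  have hΘc : Continuous Θ := hΘ.continuous
  -- `R₀`: a small ball about `X₀` on which `Θ ≤ Θ X₀ + δ/2`
  obtain ⟨R₀, hR₀0, hR₀s, hR₀Θ⟩ : ∃ R₀ : ℝ, 0 < R₀ ∧ R₀ < ‖X₁ - X₀‖ ∧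
      ∀ y, ‖y - X₀‖ ≤ R₀ → Θ y ≤ Θ X₀ + δ / 2 := by
    obtain ⟨η, hη0, hη⟩ := Metric.continuousAt_iff.1 hΘc.continuousAt (δ / 2) (half_pos hδ0)
    refine ⟨min (η / 2) (‖X₁ - X₀‖ / 2), lt_min (half_pos hη0) (half_pos hs₁0),
      (min_le_right _ _).trans_lt (half_lt_self hs₁0), fun y hy => ?_⟩
    have hdist : dist y X₀ < η := by
      rw [dist_eq_norm]; exact (hy.trans (min_le_left _ _)).trans_lt (half_lt_self hη0)
    have := hη hdist
    rw [Real.dist_eq] at this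
    linarith [(abs_lt.1 this).2]
  -- `β` and the barrier `φ = exp(-β |y - X₀|²)`
  obtain ⟨β, hβ0, hβeq⟩ : ∃ β : ℝ, 0 < β ∧
      4 * ν * β * R₀ ^ 2 = 2 * M₁ * R₀ + 2 * (Module.finrank ℝ E : ℝ) * ν + 1 := by
    refine ⟨(2 * M₁ * R₀ + 2 * (Module.finrank ℝ E : ℝ) * ν + 1) / (4 * ν * R₀ ^ 2),
      by positivity, ?_⟩
    field_simp
  obtain ⟨φ, hφ⟩ : ∃ φ : E → ℝ, φ = gaussAt (-β) X₀ := ⟨_, rfl⟩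
  have hφ2 : ContDiff ℝ 2 φ := hφ ▸ contDiff_gaussAt _ _
  have hφle1 : ∀ y, φ y ≤ 1 := fun y => hφ ▸ gaussAt_le_one_of_nonpos (by linarith) _ _
  have hφpos : ∀ y, 0 < φ y := fun y => hφ ▸ gaussAt_pos _ _ _
  have hφL : ∀ y, R₀ ≤ ‖y - X₀‖ → β * φ y ≤ driftOp ν a U φ y := by
    intro y hy
    have h1 := driftOp_gaussAt_neg_lower (ν := ν) hb hba.le hβ0.le hU X₀ y
    have hq := one_le_barrier_quad hν.le hM₁0 hd0 hR₀0 hβeq hy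
    rw [← hM₁] at h1
    rw [hφ]
    refine le_trans ?_ h1
    have h0 : 0 ≤ β * gaussAt (-β) X₀ y := mul_nonneg hβ0.le (gaussAt_pos _ _ _).le
    have := mul_le_mul_of_nonneg_left hq h0
    linarith
  -- `κ₁` and the penalisation `ψ = exp(κ₁ |y - X₀|²)`
  obtain ⟨κ₀, hκ₀0, hκκ₀, hκ₀lt⟩ : ∃ κ₀ : ℝ, 0 ≤ κ₀ ∧ κ ≤ κ₀ ∧ κ₀ < (a - b) / (2 * ν) :=
    ⟨max κ 0, le_max_right _ _, le_max_left _ _, max_lt hκ (by positivity)⟩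
  obtain ⟨κ₁, hκ₀₁, hκ₁lt⟩ : ∃ κ₁ : ℝ, κ₀ < κ₁ ∧ κ₁ < (a - b) / (2 * ν) :=
    ⟨(κ₀ + (a - b) / (2 * ν)) / 2, by linarith, by linarith⟩
  have hκ₁0 : 0 < κ₁ := hκ₀0.trans_lt hκ₀₁
  obtain ⟨B, hB0, hB⟩ : ∃ B : ℝ, 0 < B ∧ B = 2 * (a - b) - 4 * ν * κ₁ := by
    refine ⟨_, ?_, rfl⟩
    have : 4 * ν * κ₁ < 4 * ν * ((a - b) / (2 * ν)) := by gcongr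
    have e : 4 * ν * ((a - b) / (2 * ν)) = 2 * (a - b) := by field_simp; ring
    linarith
  obtain ⟨R₁, hR₁1, hR₁s, hR₁B⟩ : ∃ R₁ : ℝ, 1 ≤ R₁ ∧ ‖X₁ - X₀‖ + 1 ≤ R₁ ∧
      (2 * M₁ + 2 * (Module.finrank ℝ E : ℝ) * ν + 1) / B ≤ R₁ :=
    ⟨max (max 1 (‖X₁ - X₀‖ + 1)) ((2 * M₁ + 2 * (Module.finrank ℝ E : ℝ) * ν + 1) / B),
      (le_max_left _ _).trans (le_max_left _ _), (le_max_right _ _).trans (le_max_left _ _),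
      le_max_right _ _⟩
  have hR₀R₁ : R₀ < R₁ := by linarith
  have hs₁R₁ : ‖X₁ - X₀‖ ≤ R₁ := by linarith
  obtain ⟨ψ, hψ⟩ : ∃ ψ : E → ℝ, ψ = gaussAt κ₁ X₀ := ⟨_, rfl⟩
  have hψ2 : ContDiff ℝ 2 ψ := hψ ▸ contDiff_gaussAt _ _
  have hψpos : ∀ y, 0 < ψ y := fun y => hψ ▸ gaussAt_pos _ _ _
  have hψle : ∀ y, ‖y - X₀‖ ≤ R₁ → ψ y ≤ Real.exp (κ₁ * R₁ ^ 2) := fun y hy =>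
    hψ ▸ gaussAt_mono_radius hκ₁0.le _ hy
  have hψeq : ∀ y, ψ y = Real.exp (κ₁ * ‖y - X₀‖ ^ 2) := fun y => by rw [hψ]; rfl
  have hψL_far : ∀ y, R₁ ≤ ‖y - X₀‖ → driftOp ν a U ψ y ≤ -(κ₁ * ψ y) := by
    intro y hy
    have h1 := driftOp_gaussAt_upper (ν := ν) hb hba.le hκ₁0.le hU X₀ y
    rw [← hM₁, ← hB] at h1
    have hBr : 2 * M₁ + 2 * (Module.finrank ℝ E : ℝ) * ν + 1 ≤ B * ‖y - X₀‖ := by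
      have := (div_le_iff₀ hB0).1 (hR₁B.trans hy)
      nlinarith
    have hq := one_le_penal_quad hν.le hd0 (hR₁1.trans hy) hBr
    rw [hψ]
    refine h1.trans ?_
    have h0 : 0 ≤ κ₁ * gaussAt κ₁ X₀ y := mul_nonneg hκ₁0.le (gaussAt_pos _ _ _).le
    have := mul_le_mul_of_nonneg_left hq h0
    linarith
  obtain ⟨K, hK0, hK⟩ : ∃ K : ℝ, 0 ≤ K ∧ K = κ₁ * Real.exp (κ₁ * R₁ ^ 2) *
      (4 * ν * κ₁ * R₁ ^ 2 + 2 * (Module.finrank ℝ E : ℝ) * ν +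
        2 * (M₁ + (a + b) * R₁) * R₁) := ⟨_, by positivity, rfl⟩
  have hψL_near : ∀ y, ‖y - X₀‖ ≤ R₁ → |driftOp ν a U ψ y| ≤ K := by
    intro y hy
    have h1 := abs_driftOp_gaussAt_le hν.le hb hba.le hκ₁0.le hU X₀ y
    rw [← hM₁] at h1
    rw [hψ]
    refine h1.trans ?_
    rw [hK]
    have hr0 : 0 ≤ ‖y - X₀‖ := norm_nonneg _
    gcongr
    exact gaussAt_mono_radius hκ₁0.le _ hy
  -- the constants `γ`, `α` and the auxiliary function `V = Θ + α (φ - γ ψ)`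
  obtain ⟨Φm, hΦm0, hφL_mid⟩ : ∃ Φm : ℝ, 0 < Φm ∧
      ∀ y, R₀ ≤ ‖y - X₀‖ → ‖y - X₀‖ ≤ R₁ → Φm ≤ driftOp ν a U φ y := by
    refine ⟨β * Real.exp (-β * R₁ ^ 2), by positivity, fun y hy hy' => ?_⟩
    refine le_trans ?_ (hφL y hy)
    rw [hφ]
    exact mul_le_mul_of_nonneg_left (gaussAt_anti_radius (by linarith) X₀ hy') hβ0.le
  obtain ⟨γ, hγ0, hγK⟩ : ∃ γ : ℝ, 0 < γ ∧ γ * K < Φm := by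
    refine ⟨Φm / (2 * (K + 1)), by positivity, ?_⟩
    rw [div_mul_eq_mul_div, div_lt_iff₀ (by positivity)]
    nlinarith
  obtain ⟨S, hS0, hS⟩ : ∃ S : ℝ, 0 < S ∧ S = 1 + γ * Real.exp (κ₁ * R₁ ^ 2) :=
    ⟨_, by positivity, rfl⟩
  have hφψ : ∀ y, ‖y - X₀‖ ≤ R₁ → |φ y - γ * ψ y| ≤ S := by
    intro y hy
    refine (abs_sub _ _).trans ?_
    rw [abs_of_pos (hφpos y), abs_of_pos (mul_pos hγ0 (hψpos y)), hS]
    gcongr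
    · exact hφle1 y
    · exact hψle y hy
  obtain ⟨α, hα0, hαS⟩ : ∃ α : ℝ, 0 < α ∧ α * S = δ / 8 :=
    ⟨δ / (8 * S), by positivity, by field_simp⟩
  obtain ⟨V, hV⟩ : ∃ V : E → ℝ, V = Θ + α • (φ - γ • ψ) := ⟨_, rfl⟩
  have hVapply : ∀ y, V y = Θ y + α * (φ y - γ * ψ y) := fun y => by
    simp only [hV, Pi.add_apply, Pi.smul_apply, Pi.sub_apply, smul_eq_mul]
  have hV2 : ContDiff ℝ 2 V :=
    hV ▸ hΘ.add (contDiff_const.smul (hφ2.sub (contDiff_const.smul hψ2)))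
  have hLV : ∀ y, driftOp ν a U V y =
      driftOp ν a U Θ y + α * (driftOp ν a U φ y - γ * driftOp ν a U ψ y) := fun y =>
    hV ▸ driftOp_add_smul_sub ν a U hΘ hφ2 hψ2 α γ y
  -- `V X₁` is large, `V` is small on the small ball
  have hVX₁ : Θ X₀ + 7 * δ / 8 ≤ V X₁ := by
    rw [hVapply]
    have h1 := hφψ X₁ hs₁R₁
    have h2 : -S ≤ φ X₁ - γ * ψ X₁ := (neg_le_neg h1).trans (neg_abs_le _)
    have h3 := mul_le_mul_of_nonneg_left h2 hα0.le
    rw [mul_neg, hαS] at h3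
    linarith
  have hVsmall : ∀ y, ‖y - X₀‖ ≤ R₀ → V y < V X₁ := by
    intro y hy
    rw [hVapply]
    have h1 := hφψ y (hy.trans hR₀R₁.le)
    have h2 : φ y - γ * ψ y ≤ S := (le_abs_self _).trans h1
    have h3 := mul_le_mul_of_nonneg_left h2 hα0.le
    rw [hαS] at h3
    have h4 := hR₀Θ y hy
    linarith
  -- decay at infinity: `V ≤ V X₁` outside a large ball
  obtain ⟨R₂, hR₁R₂, hVfar⟩ : ∃ R₂ : ℝ, R₁ ≤ R₂ ∧ ∀ y, R₂ ≤ ‖y - X₀‖ → V y ≤ V X₁ :=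
    le_far_of_gauss_penalisation hC hgrowth hκκ₀ hκ₀0 hκ₀₁ hκ₁0 hψeq hφle1 hα0 hγ0
      hVapply X₁ R₁
  -- a global maximum `X₂` of `V`, where `L V ≤ 0`
  obtain ⟨X₂, hX₂⟩ : ∃ X₂, ∀ y, V y ≤ V X₂ :=
    exists_forall_le_of_le_outside hV2.continuous (hs₁R₁.trans hR₁R₂) hVfar
  have hLV2 : driftOp ν a U V X₂ ≤ 0 := driftOp_nonpos_of_isMax hν.le U hV2 hX₂
  rw [hLV] at hLV2
  have hΘ2 := hsub X₂
  -- case analysis on the position of `X₂`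
  rcases le_or_gt ‖X₂ - X₀‖ R₀ with h1 | h1
  · exact absurd (hX₂ X₁) (not_le.2 (hVsmall X₂ h1))
  have hpos : 0 < driftOp ν a U φ X₂ - γ * driftOp ν a U ψ X₂ := by
    rcases le_or_gt ‖X₂ - X₀‖ R₁ with h2 | h2
    · have hφ2' := hφL_mid X₂ h1.le h2
      have hψ2' := (le_abs_self _).trans (hψL_near X₂ h2)
      have := mul_le_mul_of_nonneg_left hψ2' hγ0.le
      linarith
    · have hφ2' := hφL X₂ (hR₀R₁.le.trans h2.le)
      have hψ2' := hψL_far X₂ h2.le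
      have e1 := mul_pos hβ0 (hφpos X₂)
      have e2 := mul_pos hγ0 (mul_pos hκ₁0 (hψpos X₂))
      have := mul_le_mul_of_nonneg_left hψ2' hγ0.le
      have e3 : γ * -(κ₁ * ψ X₂) = -(γ * (κ₁ * ψ X₂)) := by ring
      linarith
  have := mul_pos hα0 hpos
  linarith

/-- **Tsai 1998, Lemma 5.1, in Tsai's form (corrected growth).** Let `E` be a finite-dimensional
real inner product space (Tsai: `ℝ³`; Remark 5.2: any `ℝⁿ`), `ν > 0`, and let `Θ ∈ C²(E)`,
`U : E → E` continuous, satisfy `−νΔΘ + (U + a y)·∇Θ ≤ 0` on `E`. If `|U(y)| ≤ b|y|` for some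
`b ∈ [0, a)` and all `|y| ≥ r₀`, and `|Θ(y)| ≤ C e^{κ|y|²}` with `κ < (a − b)/(2ν)` (replacing the
printed `o(∫₂^{|y|} e^{cs²/2} ds)`, `c = (a − b)/ν`, which is too weak — see the module
docstring), then `Θ` is constant. (`U` is bounded on the ball `|y| ≤ r₀`, whence an affine
bound `|U| ≤ M + b|y|`, and `isConst_of_driftOp_nonneg` applies.) [cite: Tsai1998, Lemma 5.1] -/
theorem isConst_of_driftOp_nonneg_of_eventually {ν a b κ C r₀ : ℝ} (hν : 0 < ν) (hb : 0 ≤ b)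
    (hba : b < a) (hκ : κ < (a - b) / (2 * ν)) {Θ : E → ℝ} {U : E → E} (hΘ : ContDiff ℝ 2 Θ)
    (hUc : Continuous U) (hsub : ∀ y, 0 ≤ driftOp ν a U Θ y)
    (hU : ∀ y, r₀ ≤ ‖y‖ → ‖U y‖ ≤ b * ‖y‖)
    (hgrowth : ∀ y, |Θ y| ≤ C * Real.exp (κ * ‖y‖ ^ 2)) (x y : E) : Θ x = Θ y := by
  -- `U` is bounded on the closed ball of radius `r₀`
  obtain ⟨M, hM⟩ : ∃ M, ∀ z ∈ closedBall (0 : E) r₀, ‖U z‖ ≤ M :=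
    (isCompact_closedBall (0 : E) r₀).exists_bound_of_continuousOn hUc.continuousOn
  refine isConst_of_driftOp_nonneg (M := max M 0) hν hb hba hκ hΘ hsub (fun z => ?_) hgrowth x y
  by_cases hz : r₀ ≤ ‖z‖
  · exact (hU z hz).trans (le_add_of_nonneg_left (le_max_right _ _))
  · have hz' : z ∈ closedBall (0 : E) r₀ := by
      rw [mem_closedBall, dist_zero_right]; exact (not_le.1 hz).le
    exact (hM z hz').trans ((le_max_left _ _).trans (le_add_of_nonneg_right (by positivity)))

/-- **Tsai's Liouville-type lemma for polynomially bounded subsolutions** — the case used in the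
proofs of Tsai's Theorems 1 and 2 ("the growth estimates `U(y) = o(|y|)`, `Π(y) = O(|y|^N)` …
Lemma 5.1 then implies that `Π` is constant", Tsai 1998, p. 48). Let `ν > 0`, `0 ≤ b < a`,
`Θ ∈ C²(E)`, `U` continuous with `|U(y)| ≤ b|y|` for `|y| ≥ r₀`, `−νΔΘ + (U + a y)·∇Θ ≤ 0` on `E`,
and `|Θ(y)| ≤ C(1 + |y|)^N`. Then `Θ` is constant. [cite: Tsai1998, Lemma 5.1 and p. 48 (proofs of Theorems 1 and 2)] -/
theorem isConst_of_driftOp_nonneg_of_poly {ν a b C r₀ : ℝ} {N : ℕ} (hν : 0 < ν) (hb : 0 ≤ b)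
    (hba : b < a) {Θ : E → ℝ} {U : E → E} (hΘ : ContDiff ℝ 2 Θ) (hUc : Continuous U)
    (hsub : ∀ y, 0 ≤ driftOp ν a U Θ y) (hU : ∀ y, r₀ ≤ ‖y‖ → ‖U y‖ ≤ b * ‖y‖)
    (hgrowth : ∀ y, |Θ y| ≤ C * (1 + ‖y‖) ^ N) (x y : E) : Θ x = Θ y := by
  have hC : 0 ≤ C := by
    have h := (abs_nonneg _).trans (hgrowth 0)
    rw [norm_zero, add_zero, one_pow, mul_one] at h
    exact h
  -- a Gaussian rate `κ = (a - b)/(4ν) < (a - b)/(2ν)`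
  set κ := (a - b) / (4 * ν) with hκ
  have hab : 0 < a - b := sub_pos.2 hba
  have hκ0 : 0 < κ := by positivity
  have hκlt : κ < (a - b) / (2 * ν) := by
    rw [hκ, div_lt_div_iff₀ (by positivity) (by positivity)]
    nlinarith
  refine isConst_of_driftOp_nonneg_of_eventually (C := C * (N.factorial * Real.exp (1 + 1 / (4 * κ))))
    hν hb hba hκlt hΘ hUc hsub hU (fun z => (hgrowth z).trans ?_) x y
  rw [mul_assoc]
  exact mul_le_mul_of_nonneg_left (one_add_pow_le_exp_mul_sq hκ0 N (norm_nonneg z)) hC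

end Liouville

end Literature.Analysis.FluidPDE

end
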